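import Literature.NumberTheory.GaloisRepresentations.LubinTateComparisonDifferentialUnramified
import Literature.NumberTheory.GaloisRepresentations.LubinTateColemanRelativeCoatesWilesTwo
import Literature.NumberTheory.GaloisRepresentations.LubinTateComparisonReflectionTwo
import Literature.NumberTheory.EllipticCurves.PAdicOneVariableSocketUnramifiedReading
import HarnessLib

/-!
# `p = 2`: the socket of the measure lane IS the Coates–Wiles homomorphism —
# `[S⁰] D^k (((δg)~)^j ∘ ϑ) = ε^k · j((1 − w·π′^k) · φ^{CW}_{k+1}(g))`, `D = (1+S) d/dS`
# (de Shalit I §3.5 (11) second form, II §4.7 (17), II §4.10 line 1, at `q = 2`)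

Topic `NumberTheory/EllipticCurves`; namespace `Literature.NumberTheory.EllipticCurves` (sequel of
`PAdicOneVariableNormCoherentUnitInduceMomentsTwo.lean`, whose ★★
`integral_induce_ltCharacter_pow_succ_normCoherentUnits` computes the moments of de Shalit's measure
`i(b) = induce D b` of a norm-coherent unit at `p = 2` as the SOCKET
`[S^0] D^k (((δ(η b))~)^j ∘ ϑ)` — `D = mahlerD = (1+S) d/dS`, `ϑ = compSeriesC h2 hσ₀ u hε` Lubin–Tate's
comparison series from `f = 2X + X² = [2]_{Ĝ_m}` to `f′ = π′X + X²`, `π′ = 2u`, `δ` Coleman's logarithmic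
derivative for `f′`, `~` de Shalit's tilde `tildeSer π′ w` — and of
`Literature/NumberTheory/GaloisRepresentations/LubinTateComparisonDifferentialUnramified.lean`, which proved
for EVERY `q` that the `f`-side moment `[X⁰](ω_f^j·d/dX)^[k] (h^j ∘ ϑ)` is `ε^k · j([X⁰] (invDeriv hπ′ ^ k) h)`).

De Shalit, *Iwasawa theory of elliptic curves with complex multiplication* (1987), I §3.5 (p. 18):
"in terms of `S`, `D = (1+S) d/dS` […] (11) `∫_G κ(σ)^k dμ_β(σ) = D^k log g_β(0)` […] When `F_f` is an
(absolute) Lubin Tate group […] this can also be written `(1 − π^k/p) D^k log g_β(0)`"; II §4.10 line 1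
`δ_{k,n}(β) = ((Ω_p/λ′(t)) d/dt)^k log g (t)|_{t = θ(ς_n − 1)}`.  At `q = 2` the invariant differential of
`f = 2X + X²` IS `1 + X` (§1, from the tree's `ltF_ltPoly_two_eq`: `F_f = X + Y + XY`), so the abstract
`f`-side derivation `ω_f · d/dX` of the previous file IS `mahlerD`, and the lane's socket becomes, VERBATIM
in its own currency (§2):

* ★★★ `constantCoeff_mahlerD_iterate_subst_compSeriesC`
  **`[S⁰] D^k (h^j ∘ ϑ) = ε^k · j([X⁰] (invDeriv hπ′ ^ k) h)`** for every `h ∈ 𝒪[F]⟦X⟧`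
  (`ε = coeff 1 ϑ` = de Shalit's `Ω_p`, `j = intToUnrCoeff F ∘ (LTCoeff.of F)⁻¹`);
* ★★★ `constantCoeff_mahlerD_iterate_subst_compSeriesC_tildeSer_logDeriv`
  **`[S⁰] D^k (((δg)~)^j ∘ ϑ) = ε^k · j((1 − w·π′^k) · coatesWiles hπ′ k g)`** for every unit `g` — and for a
  norm-coherent unit `β ∈ 𝒰` (`…_normCoherentUnits`): **`= ε^k · j((1 − w·π′^k) · β.coatesWiles k)`**, i.e.
  THE SOCKET IS `Ω_p^k ×` (EULER FACTOR) `×` THE COATES–WILES HOMOMORPHISM `φ^{CW}_{k+1}(β) = D^{k+1} log g_β(0)`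
  (in the lane `w = u`, `π′ = 2u`, so `2·(1 − w π′^k) = 2 − π′^{k+1}`: de Shalit's `1 − π′^{k+1}/p`).

* §3 ★★★ the RELATIVE socket over an unramified base `E` (the lane's one-`𝔓` currency,
  `PAdicOneVariableSeriesFamilyOfRelNormCoherentUnits`: `H_β = j((δ_E g_β)~) ∘ ϑ`):
  `constantCoeff_mahlerD_iterate_subst_compSeriesC_relTildeSeries`
  **`[S⁰] D^k ((((δ_E g_β)~)^j ∘ ϑ) = ε^k · j(c − w·π′^k·φ(c))`**, `c = [X⁰] D_E^[k](δ_E g_β) = φ^{CW,E}_{k+1}(β)`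
  (de Shalit II §4.7 (17): the Euler factor is twisted by the Frobenius `φ` of the base;
  `LubinTateColemanRelativeCoatesWilesTwo.lean`).

What remains of de Shalit II §4.9–4.10 for the lane (`B6`, the CM bridge) is thereby the identity
`coatesWiles_k(g_{e(𝔞)}) = −12 · (d/dz)^{k+1} log Θ(Ω − z; L, 𝔞)|_{z=0}`-type statement (Eisenstein numbers)
for the Coleman series of the elliptic units — the `T₂`-side entrance of the receptacle
`MomentIdentification` / `ComplexSide` of the `SplitBadTwoLowerHalfOfFacts` docket (k3-g43).
Everything is a theorem; no definitions, no instances beyond the section-local attributes of the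
sibling files, no named facts, no `sorry`.  Cell `bsd-print-cf2`, width seat `bsd-line-cf2c-w4` g11.

## References

* [deShalit1987] E. de Shalit, *Iwasawa theory of elliptic curves with complex multiplication*,
  Perspectives in Math. 3 (1987), Ch. I §3.2 (p. 17), §3.3 (7′), §3.5 (11) (p. 18), II §4.7 (17)
  (p. 60), II §4.10 (p. 64).
* [CoatesWiles1977] J. Coates, A. Wiles, *On the conjecture of Birch and Swinnerton-Dyer*, Invent.
  Math. 39 (1977).
-/

noncomputable section

open PowerSeries

namespace Literature.NumberTheory.EllipticCurves

section SocketTwo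

open ValuativeRel IsLocalRing Field
open Literature.NumberTheory.GaloisRepresentations Literature.NumberTheory.GaloisRepresentations.IsNonarchimedeanLocalField
open Literature.NumberTheory.GaloisRepresentations.LubinTate
open Literature.NumberTheory.PAdicHodge

variable {F : Type} [Field F] [ValuativeRel F] [TopologicalSpace F] [IsNonarchimedeanLocalField F]

attribute [local instance] ltNormUniformSpace ltNormIsUniformAddGroup rk1 nF nE fintypeResidueField

variable (hq : residueFieldCard F = 2) (h2 : (valuation F).IsUniformizer (((2 : ℕ) : 𝒪[F]) : F))
  {σ₀ : absoluteGaloisGroup F} (hσ₀ : IsAbsArithFrob σ₀) (u : 𝒪[F]ˣ)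
  {ε : (maxUnramifiedCompletion F)ˣ}
  (hε : maxUnramifiedCompletion.galAut F σ₀ (ε : maxUnramifiedCompletion F) =
    algebraMap 𝒪[F] (maxUnramifiedCompletion F) (u : 𝒪[F]) * (ε : maxUnramifiedCompletion F))

/-! ### §1 At `q = 2` the invariant differential of `f = 2X + X²` is `1 + X`, so `ω_f · d/dX = mahlerD` -/

include hq in
/-- ★ **`ω_f = 1 + X` for `f = 2X + X²` at `|𝓀_F| = 2`**: the Lubin–Tate group of `2` is `X + Y + XY`
(tree `ltF_ltPoly_two_eq`), whose invariant differential `∂₁F(0, Y)` is `1 + Y` — the `(1+S)` of de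
Shalit's `D = (1+S) d/dS`. [cite: deShalit1987, Ch. I §3.2 (p. 17), §3.5 (p. 18)] -/
theorem invDiff_ltPoly_two_eq :
    invDiff (isLTRing_LTCoeff h2) (isLTSeries_LTCoeff (((2 : ℕ) : 𝒪[F]))) = 1 + PowerSeries.X := by
  have hF : ltF (isLTRing_LTCoeff h2) (isLTSeries_LTCoeff (((2 : ℕ) : 𝒪[F]))) =
      MvPowerSeries.X 0 + MvPowerSeries.X 1 + MvPowerSeries.X 0 * MvPowerSeries.X 1 :=
    ltF_ltPoly_two_eq hq h2
  ext i
  rw [coeff_invDiff, hF, map_add, map_add, map_add, PowerSeries.coeff_one, PowerSeries.coeff_X,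
    MvPowerSeries.coeff_X, MvPowerSeries.coeff_X, MvPowerSeries.X, MvPowerSeries.X,
    MvPowerSeries.monomial_mul_monomial, MvPowerSeries.coeff_monomial, one_mul]
  have key0 : (Finsupp.single (0 : Fin 2) 1 + Finsupp.single 1 i = Finsupp.single 0 1) ↔ i = 0 := by
    constructor
    · intro h
      have := Finsupp.ext_iff.mp h 1
      simpa using this
    · rintro rfl; simp
  have key1 : ¬ (Finsupp.single (0 : Fin 2) 1 + Finsupp.single 1 i = Finsupp.single 1 1) := by
    intro h
    have := Finsupp.ext_iff.mp h 0
    simp at this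
  have key2 : (Finsupp.single (0 : Fin 2) 1 + Finsupp.single 1 i =
      Finsupp.single 0 1 + Finsupp.single 1 1) ↔ i = 1 := by
    constructor
    · intro h
      have := Finsupp.ext_iff.mp h 1
      simpa using this
    · rintro rfl; rfl
  simp only [key0, key1, key2, if_false, add_zero]

include hq in
/-- `ω_f` read in any `𝒪[F]`-algebra is still `1 + X` (`q = 2`, `f = 2X + X²`).
[cite: deShalit1987, Ch. I §3.5 (p. 18)] -/
theorem map_invDiff_ltPoly_two_eq {B : Type*} [CommRing B] (j : LTCoeff F →+* B) :
    (invDiff (isLTRing_LTCoeff h2) (isLTSeries_LTCoeff (((2 : ℕ) : 𝒪[F])))).map j = 1 + PowerSeries.X := by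
  rw [invDiff_ltPoly_two_eq hq h2, map_add, map_one, map_X]

omit [TopologicalSpace F] [IsNonarchimedeanLocalField F] in
/-- De Shalit's `D = (1+S) d/dS` iterated: `mahlerD^[k] = ((1 + X) · d/dX)^[k]` (unfolding).
[cite: deShalit1987, Ch. I §3.5 (p. 18)] -/
theorem mahlerD_iterate_eq {R : Type*} [CommRing R] (k : ℕ) (P : PowerSeries R) :
    mahlerD^[k] P = (fun g : PowerSeries R => (1 + PowerSeries.X) * d⁄dX R g)^[k] P := rfl

/-! ### §2 The socket is `ε^k ×` (Euler factor) `×` Coates–Wiles -/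

include hq in
/-- ★★★ **`[S⁰] D^k (h^j ∘ ϑ) = ε^k · j([X⁰] (invDeriv hπ′ ^ k) h)`** at `q = 2` (`D = mahlerD`,
`ϑ = compSeriesC h2 hσ₀ u hε : [2]_{Ĝ_m} → F_{f′}`, `π′ = 2u`, `ε = coeff 1 ϑ`, `j = intToUnrCoeff F ∘ (LTCoeff.of F)⁻¹`):
de Shalit's II §4.10 line 1 read at `S = 0` — the `Ĝ_m`-side `k`-th moment is `Ω_p^k` times the
Lubin–Tate-side `k`-th invariant derivative at the origin. [cite: deShalit1987, Ch. I §3.5 (11) (p. 18), II §4.10 (p. 64)] -/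
theorem constantCoeff_mahlerD_iterate_subst_compSeriesC (k : ℕ) (h : PowerSeries (LTCoeff F)) :
    PowerSeries.constantCoeff (mahlerD^[k]
        ((h.map ((intToUnrCoeff F).comp (LTCoeff.of F).symm.toRingHom)).subst (compSeriesC h2 hσ₀ u hε))) =
      PowerSeries.coeff 1 (compSeriesC h2 hσ₀ u hε) ^ k *
        (intToUnrCoeff F).comp (LTCoeff.of F).symm.toRingHom
          (PowerSeries.constantCoeff ((invDeriv (isUniformizer_unit_mul h2 u) ^ k) h)) := by
  rw [mahlerD_iterate_eq, ← map_invDiff_ltPoly_two_eq hq h2 ((intToUnrCoeff F).comp (LTCoeff.of F).symm.toRingHom)]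
  exact constantCoeff_iterate_derivation_subst_compSeriesC h2 u hσ₀ hε k h

include hq in
/-- ★★★ **For Coleman's `δg` of a unit `g`: `[S⁰] D^k ((δg)^j ∘ ϑ) = ε^k · j(coatesWiles hπ′ k g)`** — the
`Ĝ_m`-side socket WITHOUT tilde is the period to the `k` times the Coates–Wiles homomorphism
`φ^{CW}_{k+1}(g) = [X⁰] D_{f′}^k δg = D_{f′}^{k+1} log g (0)`. [cite: deShalit1987, Ch. I §3.5 (11) (p. 18), II §4.10 (p. 64)] -/
theorem constantCoeff_mahlerD_iterate_subst_compSeriesC_logDeriv (k : ℕ) (g : (PowerSeries (LTCoeff F))ˣ) :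
    PowerSeries.constantCoeff (mahlerD^[k]
        (((logDeriv (isUniformizer_unit_mul h2 u) g).map
            ((intToUnrCoeff F).comp (LTCoeff.of F).symm.toRingHom)).subst (compSeriesC h2 hσ₀ u hε))) =
      PowerSeries.coeff 1 (compSeriesC h2 hσ₀ u hε) ^ k *
        (intToUnrCoeff F).comp (LTCoeff.of F).symm.toRingHom (coatesWiles (isUniformizer_unit_mul h2 u) k g) := by
  rw [constantCoeff_mahlerD_iterate_subst_compSeriesC hq, coatesWiles_def]

include hq in
/-- ★★★ **THE SOCKET WITH DE SHALIT'S TILDE**: for every unit `g` and every tilde parameter `w`,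
`[S⁰] D^k ((((δg)~)^j ∘ ϑ) = ε^k · j((1 − w·π′^k) · coatesWiles hπ′ k g)` (`(δg)~ = tildeSer π′ w (δg)`,
`π′ = 2u`) — "(1 − π^k/p) D^k log g_β(0)" of I §3.5 (11) / "δ̃_k = δ_k − p^{k−1}σ_𝔭(δ_k)" of II §4.7 (17),
times `Ω_p^k`. [cite: deShalit1987, Ch. I §3.5 (11) (p. 18), II §4.7 (17) (p. 60), II §4.10 (p. 64)] -/
theorem constantCoeff_mahlerD_iterate_subst_compSeriesC_tildeSer_logDeriv (w : LTCoeff F) (k : ℕ)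
    (g : (PowerSeries (LTCoeff F))ˣ) :
    PowerSeries.constantCoeff (mahlerD^[k]
        (((tildeSer ((u : 𝒪[F]) * ((2 : ℕ) : 𝒪[F])) w (logDeriv (isUniformizer_unit_mul h2 u) g)).map
            ((intToUnrCoeff F).comp (LTCoeff.of F).symm.toRingHom)).subst (compSeriesC h2 hσ₀ u hε))) =
      PowerSeries.coeff 1 (compSeriesC h2 hσ₀ u hε) ^ k *
        (intToUnrCoeff F).comp (LTCoeff.of F).symm.toRingHom
          ((1 - w * LTCoeff.of F ((u : 𝒪[F]) * ((2 : ℕ) : 𝒪[F])) ^ k) *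
            coatesWiles (isUniformizer_unit_mul h2 u) k g) := by
  rw [constantCoeff_mahlerD_iterate_subst_compSeriesC hq, constantCoeff_invDeriv_pow_tildeSer_logDeriv]

include hq in
/-- ★★★ **… for a norm-coherent unit `β ∈ 𝒰` of the tower of `f′ = π′X + X²`** (the lane's `η b`), in the
EXACT currency of `integral_induce_ltCharacter_pow_succ_normCoherentUnits` (tilde parameter `w`, there
`w = u`): `[S⁰] D^k (((δβ)~)^j ∘ ϑ) = ε^k · j((1 − w·π′^k) · β.coatesWiles k)` — the moments of de Shalit's
`i(β)` are `Ω_p^k ×` (Euler factor) `×` the Coates–Wiles homomorphisms `φ^{CW}_{k+1}(β)`.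
[cite: deShalit1987, Ch. I §3.5 (11) (p. 18), II §4.7 (16)–(17) (p. 60), II §4.10 (p. 64)] -/
theorem constantCoeff_mahlerD_iterate_subst_compSeriesC_tildeSer_normCoherentUnits (w : LTCoeff F) (k : ℕ)
    (β : NormCoherentUnits (isUniformizer_unit_mul h2 u)) :
    PowerSeries.constantCoeff (mahlerD^[k]
        (((tildeSer ((u : 𝒪[F]) * ((2 : ℕ) : 𝒪[F])) w β.logDeriv).map
            ((intToUnrCoeff F).comp (LTCoeff.of F).symm.toRingHom)).subst (compSeriesC h2 hσ₀ u hε))) =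
      PowerSeries.coeff 1 (compSeriesC h2 hσ₀ u hε) ^ k *
        (intToUnrCoeff F).comp (LTCoeff.of F).symm.toRingHom
          ((1 - w * LTCoeff.of F ((u : 𝒪[F]) * ((2 : ℕ) : 𝒪[F])) ^ k) * β.coatesWiles k) := by
  rw [NormCoherentUnits.logDeriv_def, NormCoherentUnits.coatesWiles_def]
  exact constantCoeff_mahlerD_iterate_subst_compSeriesC_tildeSer_logDeriv hq h2 hσ₀ u hε w k _


/-! ### §3 The RELATIVE socket over an unramified base `E` (the lane's one-`𝔓` currency):
`[S⁰] D^k ((((δ_E g_β)~)^j ∘ ϑ) = ε^k · j(c − w·π′^k·φ(c))`, `c = φ^{CW,E}_{k+1}(β)` -/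

variable (E : IntermediateField F (AlgebraicClosure F)) [FiniteDimensional F E] [Normal F E] [IsGalois F E]
  (hE : E ≤ maxUnramified F)
  (j : unitBall E →+* UnrCoeff F)
  (hj : j.comp (algebraMap (LTCoeff F) (unitBall E)) = (intToUnrCoeff F).comp (LTCoeff.of F).symm.toRingHom)

include hq hj in
omit [Normal F E] [IsGalois F E] in
/-- ★★★ **The relative moments transport at `q = 2`**: for `H ∈ 𝒪_E⟦X⟧` read in `𝐃⟦X⟧` through `j` (over `𝒪_F`),
`[S⁰] D^k (H^j ∘ ϑ) = ε^k · j([X⁰] D_E^[k] H)` with `D = mahlerD`, `D_E = ω_{f′}^E · d/dX` the relative invariant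
derivation of `f′ = π′X + X²`, `π′ = 2u`. [cite: deShalit1987, Ch. I §3.5 (11) (p. 18), II §4.10 (p. 64)] -/
theorem constantCoeff_mahlerD_iterate_subst_compSeriesC_map (k : ℕ) (H : PowerSeries (unitBall E)) :
    PowerSeries.constantCoeff (mahlerD^[k] ((H.map j).subst (compSeriesC h2 hσ₀ u hε))) =
      PowerSeries.coeff 1 (compSeriesC h2 hσ₀ u hε) ^ k *
        j (PowerSeries.constantCoeff ((fun g : PowerSeries (unitBall E) =>
          (invDiff (isLTRing_LTCoeff (isUniformizer_unit_mul h2 u))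
              (isLTSeries_LTCoeff ((u : 𝒪[F]) * ((2 : ℕ) : 𝒪[F])))).map (algebraMap (LTCoeff F) (unitBall E)) *
            d⁄dX (unitBall E) g)^[k] H)) := by
  have hmap : ((invDiff (isLTRing_LTCoeff (isUniformizer_unit_mul h2 u))
        (isLTSeries_LTCoeff ((u : 𝒪[F]) * ((2 : ℕ) : 𝒪[F])))).map (algebraMap (LTCoeff F) (unitBall E))).map j =
      (invDiff (isLTRing_LTCoeff (isUniformizer_unit_mul h2 u))
        (isLTSeries_LTCoeff ((u : 𝒪[F]) * ((2 : ℕ) : 𝒪[F])))).map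
          ((intToUnrCoeff F).comp (LTCoeff.of F).symm.toRingHom) := by
    rw [← RingHom.comp_apply (PowerSeries.map j) (PowerSeries.map (algebraMap (LTCoeff F) (unitBall E))),
      ← PowerSeries.map_comp, hj]
  have hpull := comparisonChainRuleC h2 u hσ₀ hε
  rw [map_invDiff_ltPoly_two_eq hq h2, ← hmap] at hpull
  rw [mahlerD_iterate_eq]
  exact constantCoeff_iterate_derivation_subst_map_of_pullback j (constantCoeff_compSeriesC h2 hσ₀ u hε) hpull k H

include hq hj in
/-- ★★★ **THE RELATIVE SOCKET OF THE MEASURE LANE**: for a norm-coherent unit `β ∈ 𝒰_E` of the relative tower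
`E·K_{π′}^{m+1}` (`f′ = π′X + X²`, `π′ = 2u`) and every tilde parameter `w` (the lane: `w = u`),
`[S⁰] D^k ((((δ_E g_β)~)^j ∘ ϑ) = ε^k · j(c − w · π′^k · φ(c))`, `c = [X⁰] D_E^[k] (δ_E g_β) = φ^{CW,E}_{k+1}(β)` —
de Shalit's II §4.7 (15)–(17) at `p = 2` over the unramified base: the socket of
`PAdicOneVariableSeriesFamilyOfRelNormCoherentUnits` / `…EllipticUnitsLocalMoments` is the period to the
`k`, times the Frobenius-twisted Euler factor, times the RELATIVE COATES–WILES HOMOMORPHISM.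
[cite: deShalit1987, Ch. I §3.5 (11) (p. 18), II §4.7 (15)–(17) (p. 60), II §4.10 (p. 64)] -/
theorem constantCoeff_mahlerD_iterate_subst_compSeriesC_relTildeSeries (w : LTCoeff F) (k : ℕ)
    (β : RelNormCoherentUnits (isUniformizer_unit_mul h2 u) E) :
    PowerSeries.constantCoeff (mahlerD^[k]
        (((relTildeSeries (isUniformizer_unit_mul h2 u) E hq hE hσ₀ w β).map j).subst (compSeriesC h2 hσ₀ u hε))) =
      PowerSeries.coeff 1 (compSeriesC h2 hσ₀ u hε) ^ k *
        j (PowerSeries.constantCoeff ((fun g : PowerSeries (unitBall E) =>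
              (invDiff (isLTRing_LTCoeff (isUniformizer_unit_mul h2 u))
                  (isLTSeries_LTCoeff ((u : 𝒪[F]) * ((2 : ℕ) : 𝒪[F])))).map (algebraMap (LTCoeff F) (unitBall E)) *
                d⁄dX (unitBall E) g)^[k] (relLogDerivSeries (isUniformizer_unit_mul h2 u) E hq hE hσ₀ β)) -
          algebraMap (LTCoeff F) (unitBall E) w *
            algebraMap (LTCoeff F) (unitBall E) (LTCoeff.of F ((u : 𝒪[F]) * ((2 : ℕ) : 𝒪[F]))) ^ k *
            (frobUnitBall E σ₀ : unitBall E →+* unitBall E)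
              (PowerSeries.constantCoeff ((fun g : PowerSeries (unitBall E) =>
                (invDiff (isLTRing_LTCoeff (isUniformizer_unit_mul h2 u))
                    (isLTSeries_LTCoeff ((u : 𝒪[F]) * ((2 : ℕ) : 𝒪[F])))).map (algebraMap (LTCoeff F) (unitBall E)) *
                  d⁄dX (unitBall E) g)^[k] (relLogDerivSeries (isUniformizer_unit_mul h2 u) E hq hE hσ₀ β)))) := by
  rw [constantCoeff_mahlerD_iterate_subst_compSeriesC_map hq h2 hσ₀ u hε E j hj,
    constantCoeff_iterate_relDerivation_relTildeSeries]

/-- The linear coefficient of `ϑ = compSeriesC` is (the image of) the unit `ε` with `σ₀ ε = u ε` — de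
Shalit's `p`-adic period `Ω_p` (II §4.3 (10): `Ω_p^{σ−1} = …`), a UNIT of `𝒪̂_{F^nr}`.
[cite: deShalit1987, II §4.3 (10) (p. 58), II §4.4 (p. 58)] -/
theorem coeff_one_compSeriesC_eq :
    PowerSeries.coeff 1 (compSeriesC h2 hσ₀ u hε) = (UnrCoeff.of F) (ε : maxUnramifiedCompletion F) := by
  rw [compSeriesC, PowerSeries.coeff_map, coeff_one_ltComparison]
  rfl

/-- … hence a unit. [cite: deShalit1987, II §4.3 (10) (p. 58)] -/
theorem isUnit_coeff_one_compSeriesC_pow (k : ℕ) : IsUnit (PowerSeries.coeff 1 (compSeriesC h2 hσ₀ u hε) ^ k) :=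
  (isUnit_coeff_one_compSeriesC h2 hσ₀ u hε).pow k

end SocketTwo

end Literature.NumberTheory.EllipticCurves

end
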